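import Summits.NavierStokesRegularity.NavierStokesRegularity.Theorems.CircuitPump.Negative.LoadBearing

/-!
# `WakeRatchet.EternalViscousRate` (stmt-NavierStokesRegularity-25647): ZERO-PADDING of perpetual-pump witnesses
# (m modes ⊂ m + k modes) — brick 4b of the bridge «`PerpetualPump.CircuitPump` witness ⟹ dissipation-balanced
# block-DSS bounded admissible eternal solution on a `Fin 4` table of Tao's class»

The WakeRatchet cruxes quantify over `Fin 4` tables, the perpetual pump lives on `m = 2` modes (seeded graded Toda; its
`Fin 4` form with two inert components is the tree's `T_ε`, `WakeRatchetSeededToda.inTableClass_seededToda`, p817230).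
This file pads ANY witness of the clauses of `PerpetualPump.CircuitPump` by `k` inert modes, in the pump encoding
(`CircuitPumpNegative.rhsF/SolvesODE/IsDSS/IsTypeI/IsNontrivial`), with tables and solutions written by `Fin.append`
(no new definition): the padded table feeds nothing into, and reads nothing from, the new modes, so
`rhsF` restricts to the old modes (`rhsF_pad_left`) and vanishes on the new ones (`rhsF_pad_right`); hence `SolvesODE`,
`IsDSS`, `IsTypeI`, `IsNontrivial` pass to the padding (`solvesODE_pad`, `isDSS_pad`, `isTypeI_pad`, `isNontrivial_pad`).
With the bricks `…CircuitPumpClock/Table/Renorm/FarPast/Action/Assembly/Kill` (all stated for any number of modes) the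
padded witness is renormalised on `Fin (m+k)`, in particular on `Fin 4` for the pump.  HONEST LABEL: finite bookkeeping
about MODEL lattice ODEs (Tao 2016 §4); no item is closed; nothing here bears on the Navier–Stokes equations.
-/

set_option linter.dupNamespace false

noncomputable section

open scoped BigOperators
open Real Set

namespace Summit.NavierStokesRegularity.NavierStokesRegularity.Theorems.WakeRatchetCircuitPumpPad

open Summit.NavierStokesRegularity.NavierStokesRegularity.Theorems.CircuitPumpNegative

variable {m k : ℕ}

/-- The padded table on an OLD output mode reads only old modes: the circuit field of mode `castAdd k i` of the padded
system is the circuit field of mode `i` of the original one.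
[cite: Tao2016AveragedNS, §4 (4.1); elementary] -/
theorem rhsF_pad_left (lam : ℝ) (coeff : Fin m → Fin m → Fin m → Option (Fin 3) → ℝ) (X : Fin m → ℤ → ℝ → ℝ)
    (i : Fin m) (n : ℤ) (t : ℝ) :
    rhsF lam
      (Fin.append (fun i₁ : Fin m => Fin.append (fun i₂ : Fin m => Fin.append (coeff i₁ i₂)
          (fun (_ : Fin k) (_ : Option (Fin 3)) => (0 : ℝ)))
        (fun (_ : Fin k) (_ : Fin (m + k)) (_ : Option (Fin 3)) => (0 : ℝ)))
        (fun (_ : Fin k) (_ : Fin (m + k)) (_ : Fin (m + k)) (_ : Option (Fin 3)) => (0 : ℝ)))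
      (Fin.append X (fun (_ : Fin k) (_ : ℤ) (_ : ℝ) => (0 : ℝ))) (Fin.castAdd k i) n t =
    rhsF lam coeff X i n t := by
  unfold rhsF
  simp only [Fin.sum_univ_add, Fin.append_left, Fin.append_right, zero_mul, Finset.sum_const_zero, add_zero,
    mul_zero]

/-- The padded table feeds nothing into a NEW mode: the circuit field of mode `natAdd m l` of the padded system
vanishes identically. [cite: Tao2016AveragedNS, §4 (4.1); elementary] -/
theorem rhsF_pad_right (lam : ℝ) (coeff : Fin m → Fin m → Fin m → Option (Fin 3) → ℝ) (X : Fin m → ℤ → ℝ → ℝ)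
    (l : Fin k) (n : ℤ) (t : ℝ) :
    rhsF lam
      (Fin.append (fun i₁ : Fin m => Fin.append (fun i₂ : Fin m => Fin.append (coeff i₁ i₂)
          (fun (_ : Fin k) (_ : Option (Fin 3)) => (0 : ℝ)))
        (fun (_ : Fin k) (_ : Fin (m + k)) (_ : Option (Fin 3)) => (0 : ℝ)))
        (fun (_ : Fin k) (_ : Fin (m + k)) (_ : Fin (m + k)) (_ : Option (Fin 3)) => (0 : ℝ)))
      (Fin.append X (fun (_ : Fin k) (_ : ℤ) (_ : ℝ) => (0 : ℝ))) (Fin.natAdd m l) n t = 0 := by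
  unfold rhsF
  simp only [Fin.sum_univ_add, Fin.append_left, Fin.append_right, zero_mul, Finset.sum_const_zero, add_zero,
    mul_zero]

/-- **`SolvesODE` passes to the zero-padding.** [cite: Tao2016AveragedNS, §4 (4.1) and the viscous equation before Thm. 4.2; elementary] -/
theorem solvesODE_pad {lam : ℝ} {coeff : Fin m → Fin m → Fin m → Option (Fin 3) → ℝ} {X : Fin m → ℤ → ℝ → ℝ}
    (h : SolvesODE lam coeff X) :
    SolvesODE lam
      (Fin.append (fun i₁ : Fin m => Fin.append (fun i₂ : Fin m => Fin.append (coeff i₁ i₂)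
          (fun (_ : Fin k) (_ : Option (Fin 3)) => (0 : ℝ)))
        (fun (_ : Fin k) (_ : Fin (m + k)) (_ : Option (Fin 3)) => (0 : ℝ)))
        (fun (_ : Fin k) (_ : Fin (m + k)) (_ : Fin (m + k)) (_ : Option (Fin 3)) => (0 : ℝ)))
      (Fin.append X (fun (_ : Fin k) (_ : ℤ) (_ : ℝ) => (0 : ℝ))) := by
  intro j n t ht
  refine Fin.addCases (fun i => ?_) (fun l => ?_) j
  · rw [rhsF_pad_left, Fin.append_left]
    exact h i n t ht
  · rw [rhsF_pad_right, Fin.append_right]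
    exact hasDerivAt_const t (0 : ℝ)

/-- **Exact self-similarity passes to the zero-padding.** [elementary] -/
theorem isDSS_pad {lam : ℝ} {p : ℕ} {X : Fin m → ℤ → ℝ → ℝ} (h : IsDSS lam p X) :
    IsDSS lam p (Fin.append X (fun (_ : Fin k) (_ : ℤ) (_ : ℝ) => (0 : ℝ))) := by
  intro j n t ht
  refine Fin.addCases (fun i => ?_) (fun l => ?_) j
  · simp only [Fin.append_left]
    exact h i n t ht
  · simp only [Fin.append_right, mul_zero]

/-- **Type I passes to the zero-padding** (constant `max C 0`). [elementary] -/
theorem isTypeI_pad {lam : ℝ} (hlam : 1 < lam) {X : Fin m → ℤ → ℝ → ℝ} (h : IsTypeI lam X) :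
    IsTypeI lam (Fin.append X (fun (_ : Fin k) (_ : ℤ) (_ : ℝ) => (0 : ℝ))) := by
  obtain ⟨C, hC⟩ := h
  have hpos : 0 < lam := by linarith
  refine ⟨max C 0, fun j n t ht => ?_⟩
  have hsq : 0 < Real.sqrt (-t) := Real.sqrt_pos.2 (by linarith)
  refine Fin.addCases (fun i => ?_) (fun l => ?_) j
  · simp only [Fin.append_left]
    exact (hC i n t ht).trans (div_le_div_of_nonneg_right (le_max_left _ _) hsq.le)
  · simp only [Fin.append_right, abs_zero, mul_zero]
    exact div_nonneg (le_max_right _ _) hsq.le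

/-- **Non-triviality passes to the zero-padding.** [elementary] -/
theorem isNontrivial_pad {X : Fin m → ℤ → ℝ → ℝ} (h : IsNontrivial X) :
    IsNontrivial (Fin.append X (fun (_ : Fin k) (_ : ℤ) (_ : ℝ) => (0 : ℝ))) := by
  obtain ⟨i, n, t, ht, hx⟩ := h
  refine ⟨Fin.castAdd k i, n, t, ht, ?_⟩
  simp only [Fin.append_left]
  exact hx

end Summit.NavierStokesRegularity.NavierStokesRegularity.Theorems.WakeRatchetCircuitPumpPad

end
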